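import Literature.Barriers.NavierStokesRegularity.NavierStokesInequalityArrangement
import Literature.Analysis.Calculus.HadamardLemma
import Mathlib.Analysis.Calculus.BumpFunction.FiniteDimension
import Mathlib.MeasureTheory.Integral.IntervalIntegral.FundThmCalculus
import HarnessLib

/-!
# Time integrals of smooth families, `∫₀ᵗ Φ(s,·) ds`, and a smooth time clamp (Ożański 2017, §4.1)

Barrier catalogue support file for `NavierStokesRegularity` (D-0021), on the discharge path of
fact D-II `Literature.Barriers.NavierStokesRegularity.NSIProfiles_of_arrangement`
(`NavierStokesInequalityProfiles`; W. S. Ożański, arXiv:1709.00602v4, §4.1). The profiles of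
§4.1 are defined through time integrals of smooth families of planar functions:
`h²_{2,t} = f₂² - 2tδφ₂ + ∫₀ᵗ v₂·F[v₁,h_{1,s}] ds` ((4.9)) and
`(qᵏ_{i,t})² = fᵢ² - 2tδφᵢ - ∫₀ᵗ aᵢᵏ(s) vᵢ·(∇h²_{i,s} + 2∇p[a₁ᵏ(s)v₁,h_{1,s}] + 2∇p[a₂ᵏ(s)v₂,h_{2,s}]) ds`
((4.16)), which are then differentiated in `t` ((4.17): "`∂ₜ(qᵏ_{i,t})² = -2δφᵢ - aᵢᵏ(t)vᵢ·(…)`")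
and in `x` ((4.18): "`D^l qᵏ_{i,t} → D^l h_{i,t}` uniformly"), all terms being smooth ("all terms
on the right-hand side of (4.16) are smooth"). This file PROVES the calculus used there for a
family `Φ : ℝ → X → G` jointly `C^∞` (`X` finite dimensional):

* `intervalIntegral_eq_integral_unit` — `∫₀ᵗ Φ(s,x) ds = ∫₀¹ t Φ(tσ,x) dσ`;
* `contDiff_primitive_param` — `(t,x) ↦ ∫₀ᵗ Φ(s,x) ds` is jointly `C^∞`;
* `hasDerivAt_primitive_param`, `deriv_primitive_param` — `∂ₜ ∫₀ᵗ Φ(s,x) ds = Φ(t,x)`;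
* `fderiv_primitive_param_apply`, `derivR_primitive_param`, `derivZ_primitive_param` — the space
  derivatives pass under the integral sign;
* `norm_primitive_param_le` — `‖∫₀ᵗ Φ(s,x) ds‖ ≤ C|t|` under `‖Φ‖ ≤ C`;
* `exists_smooth_clamp` — a smooth `κ : ℝ → ℝ` with `κ(t) = t` on `[0,T]`, `κ' ∈ [0,1]`,
  `κ(ℝ) ⊆ [-ε, T+ε]`: composing the time of the families `h_{i,t}` with `κ` makes them globally
  defined and smooth with all the properties of Lemma 4.1 holding for every `t ∈ ℝ` (they only
  depend on the range of times), while nothing changes on `[0,T]`, where Proposition 4.2 lives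
  (Ożański obtains `t ∈ (-δ, T+δ)` "by continuity"; the clamp is this continuity made uniform).

## Mathlib / tree search

Tree: `Literature.Analysis.Calculus.contDiff_intervalIntegral`,
`….fderiv_intervalIntegral_apply_eq_partialFDerivFst`, `….fderiv_eq_partialFDerivFst`
(`HadamardLemma`); Mathlib: `intervalIntegral.smul_integral_comp_mul_left`,
`Continuous.integral_hasStrictDerivAt`, `intervalIntegral.norm_integral_le_of_norm_le_const`,
`ContDiffBump`, `contDiff_infty_iff_deriv` (used).

## References

* W. S. Ożański, *On weak solutions to the Navier–Stokes inequality with internal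
  singularities*, arXiv:1709.00602v4, Lemma 4.1 ((4.9)), §4.1 ((4.16)–(4.18)).
  [`Ozanski2017NSISingular`]
* V. Scheffer, *A solution to the Navier–Stokes inequality with an internal singularity*,
  Comm. Math. Phys. 101 (1985), Lemma 3.1 ((3.13)) and Lemma 3.2 ((3.36)–(3.39)).
  [`Scheffer1985`]
-/

noncomputable section

open Set Function Filter Topology Metric MeasureTheory intervalIntegral
open scoped ContDiff

namespace Literature.Barriers.NavierStokesRegularity

variable {X : Type*} {G : Type*} [NormedAddCommGroup G] [NormedSpace ℝ G]

/-! ### The primitive `∫₀ᵗ Φ(s,x) ds` of a jointly smooth family -/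

section Primitive

variable {Φ : ℝ → X → G}

/-- **Rescaling to the unit interval**: `∫₀ᵗ Φ(s,x) ds = ∫₀¹ t • Φ(tσ, x) dσ`. [folklore] -/
theorem intervalIntegral_eq_integral_unit (Φ : ℝ → X → G) (t : ℝ) (x : X) :
    ∫ s in (0 : ℝ)..t, Φ s x = ∫ σ in (0 : ℝ)..1, t • Φ (t * σ) x := by
  rw [intervalIntegral.integral_smul]
  have h := intervalIntegral.smul_integral_comp_mul_left (f := fun s => Φ s x) (a := (0 : ℝ))
    (b := (1 : ℝ)) t
  simp only [mul_zero, mul_one] at h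
  exact h.symm

/-- **`‖∫₀ᵗ Φ(s,x) ds‖ ≤ C |t|`** when `‖Φ(s,x)‖ ≤ C` for `s` between `0` and `t`. [folklore] -/
theorem norm_primitive_param_le {t C : ℝ} {x : X} (hC : ∀ s ∈ uIcc 0 t, ‖Φ s x‖ ≤ C) :
    ‖∫ s in (0 : ℝ)..t, Φ s x‖ ≤ C * |t| := by
  have := intervalIntegral.norm_integral_le_of_norm_le_const (a := 0) (b := t) (f := fun s => Φ s x)
    (C := C) fun s hs => hC s (uIoc_subset_uIcc hs)
  simpa using this

variable [NormedAddCommGroup X] [NormedSpace ℝ X] [FiniteDimensional ℝ X] [CompleteSpace G]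

/-- **`(t,x) ↦ ∫₀ᵗ Φ(s,x) ds` is jointly `C^∞`** for a jointly `C^∞` family (after rescaling to
`[0,1]` the integrand `(t,x,σ) ↦ tΦ(tσ,x)` is smooth in all variables; Ożański §4.1: "all terms
on the right-hand side of (4.16) are smooth"). [cite: Ozanski2017NSISingular, §4.1 (4.16)–(4.17)] -/
theorem contDiff_primitive_param (hΦ : ContDiff ℝ ∞ (uncurry Φ)) :
    ContDiff ℝ ∞ fun p : ℝ × X => ∫ s in (0 : ℝ)..p.1, Φ s p.2 := by
  have e : (fun p : ℝ × X => ∫ s in (0 : ℝ)..p.1, Φ s p.2) =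
      fun p => ∫ σ in (0 : ℝ)..1, p.1 • Φ (p.1 * σ) p.2 :=
    funext fun p => intervalIntegral_eq_integral_unit Φ p.1 p.2
  rw [e]
  have hF : ContDiff ℝ ∞ (uncurry fun (p : ℝ × X) (σ : ℝ) => p.1 • Φ (p.1 * σ) p.2) := by
    have h1 : ContDiff ℝ ∞ fun z : (ℝ × X) × ℝ => (z.1.1 * z.2, z.1.2) :=
      ((contDiff_fst.comp contDiff_fst).mul contDiff_snd).prodMk (contDiff_snd.comp contDiff_fst)
    exact (contDiff_fst.comp contDiff_fst).smul (hΦ.comp h1)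
  exact Literature.Analysis.Calculus.contDiff_intervalIntegral (n := (⊤ : ℕ∞)) hF 0 1

omit [FiniteDimensional ℝ X] in
/-- **`∂ₜ ∫₀ᵗ Φ(s,x) ds = Φ(t,x)`** (fundamental theorem of calculus; (4.17)).
[cite: Ozanski2017NSISingular, §4.1 (4.17)] -/
theorem hasDerivAt_primitive_param (hΦ : ContDiff ℝ ∞ (uncurry Φ)) (t : ℝ) (x : X) :
    HasDerivAt (fun t' => ∫ s in (0 : ℝ)..t', Φ s x) (Φ t x) t := by
  have hc : Continuous fun s => Φ s x := hΦ.continuous.comp (Continuous.prodMk_left x)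
  exact (hc.integral_hasStrictDerivAt 0 t).hasDerivAt

omit [FiniteDimensional ℝ X] in
/-- `deriv` form of `hasDerivAt_primitive_param`. [cite: Ozanski2017NSISingular, §4.1 (4.17)] -/
theorem deriv_primitive_param (hΦ : ContDiff ℝ ∞ (uncurry Φ)) (t : ℝ) (x : X) :
    deriv (fun t' => ∫ s in (0 : ℝ)..t', Φ s x) t = Φ t x :=
  (hasDerivAt_primitive_param hΦ t x).deriv

omit [FiniteDimensional ℝ X] in
/-- **Space derivatives pass under the time integral**:
`D_x(∫₀ᵗ Φ(s,·) ds)(x) y = ∫₀ᵗ D_x Φ(s,·)(x) y ds` ((4.18): the derivatives `D^l` of (4.16) are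
computed termwise under the integral). [cite: Ozanski2017NSISingular, §4.1 (4.18)] -/
theorem fderiv_primitive_param_apply (hΦ : ContDiff ℝ ∞ (uncurry Φ)) (t : ℝ) (x y : X) :
    fderiv ℝ (fun x' => ∫ s in (0 : ℝ)..t, Φ s x') x y = ∫ s in (0 : ℝ)..t, fderiv ℝ (Φ s) x y := by
  have hF : ContDiff ℝ ∞ (uncurry fun (x' : X) (s : ℝ) => Φ s x') :=
    hΦ.comp (contDiff_snd.prodMk contDiff_fst)
  have htop : (∞ : WithTop ℕ∞) ≠ 0 := by simp
  rw [Literature.Analysis.Calculus.fderiv_intervalIntegral_apply_eq_partialFDerivFst hF htop 0 t x y]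
  refine intervalIntegral.integral_congr fun s _ => ?_
  have e := Literature.Analysis.Calculus.fderiv_eq_partialFDerivFst hF htop x s
  change Literature.Analysis.Calculus.partialFDerivFst (fun (x' : X) (s : ℝ) => Φ s x') x s y =
    fderiv ℝ (Φ s) x y
  rw [← e]

/-- `∂ᵣ ∫₀ᵗ Φ(s,·) ds = ∫₀ᵗ ∂ᵣΦ(s,·) ds` for planar families. [cite: Ozanski2017NSISingular, §4.1 (4.18)] -/
theorem derivR_primitive_param {Φ : ℝ → ℝ × ℝ → G} (hΦ : ContDiff ℝ ∞ (uncurry Φ)) (t : ℝ)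
    (q : ℝ × ℝ) :
    derivR (fun q' => ∫ s in (0 : ℝ)..t, Φ s q') q = ∫ s in (0 : ℝ)..t, derivR (Φ s) q :=
  fderiv_primitive_param_apply hΦ t q (1, 0)

/-- `∂_z ∫₀ᵗ Φ(s,·) ds = ∫₀ᵗ ∂_zΦ(s,·) ds` for planar families. [cite: Ozanski2017NSISingular, §4.1 (4.18)] -/
theorem derivZ_primitive_param {Φ : ℝ → ℝ × ℝ → G} (hΦ : ContDiff ℝ ∞ (uncurry Φ)) (t : ℝ)
    (q : ℝ × ℝ) :
    derivZ (fun q' => ∫ s in (0 : ℝ)..t, Φ s q') q = ∫ s in (0 : ℝ)..t, derivZ (Φ s) q :=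
  fderiv_primitive_param_apply hΦ t q (0, 1)

end Primitive

/-! ### A smooth time clamp -/

/-- **A smooth clamp of time onto `[-ε, T+ε]`, the identity on `[0,T]`.** For `T > 0`, `ε > 0`
there is `κ ∈ C^∞(ℝ)` with `κ(t) = t` for `t ∈ [0,T]`, `κ' ∈ [0,1]` everywhere, `κ' = 1` on
`[0,T]`, and `-ε ≤ κ ≤ T + ε` (the primitive of a smooth bump equal to `1` on `[0,T]` and supported
in `(-ε, T+ε)`). Reparametrising the families of Lemma 4.1 by `κ` realises "by continuity …
`t ∈ (-δ, T+δ)`" uniformly in time. [cite: Ozanski2017NSISingular, Lemma 4.1 (proof)] -/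
theorem exists_smooth_clamp {T ε : ℝ} (hT : 0 < T) (hε : 0 < ε) :
    ∃ κ : ℝ → ℝ, ContDiff ℝ ∞ κ ∧ (∀ t ∈ Icc 0 T, κ t = t) ∧ (∀ t, κ t ∈ Icc (-ε) (T + ε)) ∧
      (∀ t, deriv κ t ∈ Icc (0 : ℝ) 1) ∧ (∀ t ∈ Icc 0 T, deriv κ t = 1) := by
  -- the bump `χ = 1` on `[0,T] = closedBall (T/2) (T/2)`, supported in `(-ε, T+ε)`
  let χ : ContDiffBump (T / 2 : ℝ) :=
    { rIn := T / 2
      rOut := T / 2 + ε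
      rIn_pos := by positivity
      rIn_lt_rOut := by linarith }
  have hrIn : χ.rIn = T / 2 := rfl
  have hrOut : χ.rOut = T / 2 + ε := rfl
  have hχs : ContDiff ℝ ∞ (χ : ℝ → ℝ) := χ.contDiff
  have hχc : Continuous (χ : ℝ → ℝ) := χ.continuous
  have hχ1 : ∀ t ∈ Icc 0 T, (χ : ℝ → ℝ) t = 1 := by
    intro t ht
    apply χ.one_of_mem_closedBall
    rw [mem_closedBall, Real.dist_eq, hrIn, abs_le]
    constructor <;> linarith [ht.1, ht.2]
  have hχ0 : ∀ t, T / 2 + ε ≤ |t - T / 2| → (χ : ℝ → ℝ) t = 0 := fun t ht =>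
    χ.zero_of_le_dist (by rw [hrOut, Real.dist_eq]; exact ht)
  have hχ01 : ∀ t, (χ : ℝ → ℝ) t ∈ Icc (0 : ℝ) 1 := fun t => ⟨χ.nonneg, χ.le_one⟩
  set κ : ℝ → ℝ := fun t => ∫ s in (0 : ℝ)..t, χ s with hκ
  have hderiv : ∀ t, HasDerivAt κ (χ t) t := fun t => (hχc.integral_hasStrictDerivAt 0 t).hasDerivAt
  have hderiv' : deriv κ = (χ : ℝ → ℝ) := funext fun t => (hderiv t).deriv
  have hκs : ContDiff ℝ ∞ κ := by
    rw [contDiff_infty_iff_deriv]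
    exact ⟨fun t => (hderiv t).differentiableAt, by rw [hderiv']; exact hχs⟩
  -- monotonicity facts from `0 ≤ χ ≤ 1`
  have hint : ∀ a b, IntervalIntegrable (χ : ℝ → ℝ) volume a b := fun a b => hχc.intervalIntegrable a b
  have hmono : ∀ a b, a ≤ b → 0 ≤ ∫ s in a..b, (χ : ℝ → ℝ) s := fun a b hab =>
    intervalIntegral.integral_nonneg hab fun s _ => χ.nonneg
  have hle : ∀ a b, a ≤ b → ∫ s in a..b, (χ : ℝ → ℝ) s ≤ b - a := by
    intro a b hab
    have := intervalIntegral.integral_mono_on hab (hint a b) intervalIntegrable_const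
      (fun s _ => (χ.le_one : (χ : ℝ → ℝ) s ≤ 1))
    simpa using this
  have hvanish : ∀ a b, a ≤ b → (∀ s ∈ Icc a b, (χ : ℝ → ℝ) s = 0) →
      ∫ s in a..b, (χ : ℝ → ℝ) s = 0 := by
    intro a b hab h0
    rw [intervalIntegral.integral_congr (g := fun _ => (0 : ℝ))
      (fun s hs => h0 s (by rwa [uIcc_of_le hab] at hs))]
    simp
  refine ⟨κ, hκs, ?_, ?_, ?_, ?_⟩
  · -- `κ = id` on `[0,T]`
    intro t ht
    have : ∫ s in (0 : ℝ)..t, (χ : ℝ → ℝ) s = ∫ s in (0 : ℝ)..t, (1 : ℝ) :=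
      intervalIntegral.integral_congr fun s hs => hχ1 s (by
        rw [uIcc_of_le ht.1] at hs; exact ⟨hs.1, hs.2.trans ht.2⟩)
    change ∫ s in (0 : ℝ)..t, (χ : ℝ → ℝ) s = t
    rw [this, intervalIntegral.integral_const, smul_eq_mul, mul_one, sub_zero]
  · -- range in `[-ε, T+ε]`
    intro t
    rcases le_or_gt 0 t with ht | ht
    · refine ⟨by linarith [hmono 0 t ht], ?_⟩
      rcases le_or_gt t (T + ε) with ht' | ht'
      · linarith [hle 0 t ht]
      · have hsplit : ∫ s in (0 : ℝ)..t, (χ : ℝ → ℝ) s =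
            (∫ s in (0 : ℝ)..(T + ε), (χ : ℝ → ℝ) s) + ∫ s in (T + ε)..t, (χ : ℝ → ℝ) s :=
          (intervalIntegral.integral_add_adjacent_intervals (hint _ _) (hint _ _)).symm
        have h2 : ∫ s in (T + ε)..t, (χ : ℝ → ℝ) s = 0 :=
          hvanish _ _ ht'.le fun s hs => hχ0 s (by
            rw [abs_of_nonneg (by linarith [hs.1])]; linarith [hs.1])
        have h1 := hle 0 (T + ε) (by linarith)
        change ∫ s in (0 : ℝ)..t, (χ : ℝ → ℝ) s ≤ T + ε
        rw [hsplit, h2, add_zero]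
        linarith
    · have hrev : ∫ s in (0 : ℝ)..t, (χ : ℝ → ℝ) s = -∫ s in t..(0 : ℝ), (χ : ℝ → ℝ) s :=
        intervalIntegral.integral_symm t 0
      refine ⟨?_, ?_⟩
      · change -ε ≤ ∫ s in (0 : ℝ)..t, (χ : ℝ → ℝ) s
        rw [hrev]
        rcases le_or_gt (-ε) t with ht' | ht'
        · linarith [hle t 0 ht.le]
        · have hsplit : ∫ s in t..(0 : ℝ), (χ : ℝ → ℝ) s =
              (∫ s in t..(-ε), (χ : ℝ → ℝ) s) + ∫ s in (-ε)..(0 : ℝ), (χ : ℝ → ℝ) s :=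
            (intervalIntegral.integral_add_adjacent_intervals (hint _ _) (hint _ _)).symm
          have h2 : ∫ s in t..(-ε), (χ : ℝ → ℝ) s = 0 :=
            hvanish _ _ ht'.le fun s hs => hχ0 s (by
              rw [abs_of_nonpos (by linarith [hs.2])]; linarith [hs.2])
          have h1 := hle (-ε) 0 (by linarith)
          rw [hsplit, h2, zero_add]
          linarith
      · change ∫ s in (0 : ℝ)..t, (χ : ℝ → ℝ) s ≤ T + ε
        rw [hrev]
        linarith [hmono t 0 ht.le]
  · intro t
    rw [hderiv']
    exact hχ01 t
  · intro t ht
    rw [hderiv']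
    exact hχ1 t ht

end Literature.Barriers.NavierStokesRegularity
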